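import Mathlib
import Summits.Ventures.PercRepro2.Defs
import Summits.Ventures.PercRepro2.Harris
import Summits.Ventures.PercRepro2.Graph
import Summits.Ventures.PercRepro2.Events
import Summits.Ventures.PercRepro2.CondAvoidPA

/-!
# The three-status grid, product boxes and box-positive-association: definitions
(blind cell PercRepro2, mine-1 g49; proofs/MINE1-UNIONROW-K3.md §15.3, MINE-1.md §66)

Three observed vertices `u, v, w` get a status in `Fin 3` relative to the roots `s, t`:
`2` (= S) if the vertex lies in the cluster of `s`, `0` (= T) if it lies in the cluster of `t`,
`1` (= N) otherwise (`status`; on `{s ↮ t}` the two clusters are disjoint).  A set of status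
triples (a set of cells of the grid `Fin 3 × Fin 3 × Fin 3`, ordered coordinatewise with
`T = 0 < N = 1 < S = 2`, the (Z)-order) defines the event `gridEvent` that the triple of statuses
lies in it.  A PRODUCT BOX is a pair of coordinate sets `X, Y ⊆ Fin 3`: the cluster of `s` avoids
the coordinates in `X` (and `t`), the cluster of `t` avoids the coordinates in `Y` (and `s`) —
`boxEvent`.  `BoxPA X Y` is the statement «the three-status law conditioned on the box `(X, Y)` is
(Z)-positively associated»: for every admissible weight vector, finite graph, roots and observed
vertices, and all up-sets `S₁, S₂` of the grid,

  `P(S₁ ∩ S₂ ∩ R) · P(R) ≥ P(S₁ ∩ R) · P(S₂ ∩ R)`,   `R = boxEvent X Y`.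

For `Y = ∅` (s avoids `X`, `t` avoids only `s`) and for `X = ∅` these are the cell's theorems
`CondAvoid.zpa_given_avoid` / `pa_given_avoid` read on the grid; for `X, Y ≠ ∅` (a MIXED box) they
are the hypotheses refuted in `MixedBoxRefutationsA/B.lean` — 33 of the 39 mixed boxes carrying a
non-nested pair of up-set traces are refuted there by witnesses on five vertices at homogeneous
weight; the remaining six (one coordinate in `X ∩ Y`, the other two both in `X ∖ Y` or both in
`Y ∖ X`, a single fact each) survive every random census on at most six vertices but are FALSE as
well: a graph on seven vertices with weights close to `1` violates them on a conditioning event of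
probability `10⁻²` (an exact rational witness, proofs/MINE1-UNIONROW-K3.md §15.3 ERRATUM,
data/mine-1/g49/mix1_witness_simple.json; its kernel evaluation over `2⁸` configurations is beyond
the walk-enumeration decision of reachability and is not included here).  So every mixed box with a
fact is false.  Definitions (`status`, `gridEvent`, `boxEvent`, `BoxPA`) and the refutation glue
(`mass`, `not_boxPA_of_mass`, the homogeneous weights `1/2` and `3/4`); no notation; the two
decidability instances are for the events of this file.
-/

namespace Summit.Ventures.PercRepro2

namespace MixedBox

variable {V : Type*} {E : Type*} [Fintype E] [DecidableEq E] [Fintype V] [DecidableEq V]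

/-- The status of `x` relative to the roots `s, t`: `2` in the cluster of `s`, `0` in the cluster
of `t`, `1` in neither (on `{s ↮ t}` these are exclusive). -/
def status (ends : E → Sym2 V) (s t x : V) (ω : Config E) : Fin 3 :=
  if Conn ends ω s x then 2 else if Conn ends ω t x then 0 else 1

/-- The event that the status triple of `(u, v, w)` lies in the cell set `S`. -/
def gridEvent (ends : E → Sym2 V) (s t u v w : V) (S : Finset (Fin 3 × Fin 3 × Fin 3)) :
    Set (Config E) :=
  {ω | (status ends s t u ω, status ends s t v ω, status ends s t w ω) ∈ S}

/-- The box `(X, Y)`: the cluster of `s` avoids `t` and the observed vertices with coordinates in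
`X`, the cluster of `t` avoids `s` and the observed vertices with coordinates in `Y`. -/
def boxEvent (ends : E → Sym2 V) (s t u v w : V) (X Y : Finset (Fin 3)) : Set (Config E) :=
  CondAvoid.avoidEvent ends s (X.image ![u, v, w] ∪ {t}) ∩
    CondAvoid.avoidEvent ends t (Y.image ![u, v, w] ∪ {s})

/-- Membership in `gridEvent` is decidable. -/
instance instDecGridEvent (ends : E → Sym2 V) (s t u v w : V)
    (S : Finset (Fin 3 × Fin 3 × Fin 3)) : DecidablePred (· ∈ gridEvent ends s t u v w S) :=
  fun ω => inferInstanceAs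
    (Decidable ((status ends s t u ω, status ends s t v ω, status ends s t w ω) ∈ S))

/-- Membership in `boxEvent` is decidable. -/
instance instDecBoxEvent (ends : E → Sym2 V) (s t u v w : V) (X Y : Finset (Fin 3)) :
    DecidablePred (· ∈ boxEvent ends s t u v w X Y) :=
  fun ω => inferInstanceAs (Decidable ((∀ x ∈ X.image ![u, v, w] ∪ {t}, ¬ Conn ends ω s x) ∧
    (∀ x ∈ Y.image ![u, v, w] ∪ {s}, ¬ Conn ends ω t x)))

end MixedBox

/-- **Box positive association** for the coordinate box `(X, Y)`: the three-status law conditioned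
on `boxEvent X Y` is (Z)-positively associated — for every admissible rational weight vector, every
finite graph with roots `s, t` and observed vertices `u, v, w`, and all up-sets `S₁, S₂` of the
grid `Fin 3 × Fin 3 × Fin 3` (coordinatewise order `T < N < S`). -/
def BoxPA (X Y : Finset (Fin 3)) : Prop :=
  ∀ (V E : Type) [Fintype V] [DecidableEq V] [Fintype E] [DecidableEq E] (p : E → ℚ),
    IsProbVec p → ∀ (ends : E → Sym2 V) (s t u v w : V) (S₁ S₂ : Finset (Fin 3 × Fin 3 × Fin 3)),
    IsUpperSet (↑S₁ : Set (Fin 3 × Fin 3 × Fin 3)) → IsUpperSet (↑S₂ : Set (Fin 3 × Fin 3 × Fin 3)) →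
    (let R := MixedBox.boxEvent ends s t u v w X Y
     let E₁ := MixedBox.gridEvent ends s t u v w S₁
     let E₂ := MixedBox.gridEvent ends s t u v w S₂
     prob p (E₁ ∩ E₂ ∩ R) * prob p R ≥ prob p (E₁ ∩ R) * prob p (E₂ ∩ R))

end Summit.Ventures.PercRepro2

namespace Summit.Ventures.PercRepro2

namespace MixedBox

variable {V : Type*} {E : Type*} [Fintype E] [DecidableEq E] [Fintype V] [DecidableEq V]

/-- A finite cell set closed upwards (checked by `decide`) is an up-set. -/
lemma upper_of_forall {S : Finset (Fin 3 × Fin 3 × Fin 3)}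
    (h : ∀ a ∈ S, ∀ b : Fin 3 × Fin 3 × Fin 3, a ≤ b → b ∈ S) :
    IsUpperSet (↑S : Set (Fin 3 × Fin 3 × Fin 3)) :=
  fun a b hab ha => h a ha b hab

/-- The integer mass of an event under integer weights `wt`. -/
def mass (wt : Config E → ℕ) (A : Set (Config E)) [DecidablePred (· ∈ A)] : ℕ :=
  ∑ ω ∈ Finset.univ.filter (· ∈ A), wt ω

/-- `P(A) = mass(A) / D` when `weight p ω = wt ω / D`. -/
lemma prob_eq_mass_div {p : E → ℚ} {wt : Config E → ℕ} {D : ℚ}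
    (hw : ∀ ω, weight p ω = (wt ω : ℚ) / D) (A : Set (Config E)) [DecidablePred (· ∈ A)] :
    prob p A = (mass wt A : ℚ) / D := by
  rw [prob_eq_sum_filter, mass, Nat.cast_sum, Finset.sum_div]
  exact Finset.sum_congr rfl fun ω _ => hw ω

/-- **Refutation glue**: a graph, roots, observed vertices and two up-sets whose integer masses
satisfy `m(E₁∩E₂∩R)·m(R) < m(E₁∩R)·m(E₂∩R)` refute `BoxPA X Y`. -/
theorem not_boxPA_of_mass {V E : Type} [Fintype V] [DecidableEq V] [Fintype E] [DecidableEq E]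
    {p : E → ℚ} (hp : IsProbVec p) (ends : E → Sym2 V) (s t u v w : V)
    {S₁ S₂ : Finset (Fin 3 × Fin 3 × Fin 3)}
    (h₁ : IsUpperSet (↑S₁ : Set (Fin 3 × Fin 3 × Fin 3)))
    (h₂ : IsUpperSet (↑S₂ : Set (Fin 3 × Fin 3 × Fin 3)))
    {wt : Config E → ℕ} {D : ℚ} (hD : 0 < D) (hw : ∀ ω, weight p ω = (wt ω : ℚ) / D)
    {X Y : Finset (Fin 3)}
    (hm : mass wt (gridEvent ends s t u v w S₁ ∩ gridEvent ends s t u v w S₂ ∩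
            boxEvent ends s t u v w X Y) * mass wt (boxEvent ends s t u v w X Y) <
          mass wt (gridEvent ends s t u v w S₁ ∩ boxEvent ends s t u v w X Y) *
            mass wt (gridEvent ends s t u v w S₂ ∩ boxEvent ends s t u v w X Y)) :
    ¬ BoxPA X Y := by
  intro h
  have key := h V E p hp ends s t u v w S₁ S₂ h₁ h₂
  simp only at key
  rw [prob_eq_mass_div hw, prob_eq_mass_div hw, prob_eq_mass_div hw, prob_eq_mass_div hw,
    div_mul_div_comm, div_mul_div_comm, ge_iff_le] at key
  have hDD : (0 : ℚ) < D * D := by positivity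
  have key' := mul_le_mul_of_nonneg_right key hDD.le
  rw [div_mul_cancel₀ _ hDD.ne', div_mul_cancel₀ _ hDD.ne'] at key'
  norm_cast at key'
  exact absurd key' (not_le.mpr hm)

/-- Homogeneous weight `1/2` on four edges. -/
def p12 : Fin 4 → ℚ := fun _ => 1 / 2

/-- Integer weights for `p12`: every configuration has weight `1` (in sixteenths). -/
def wt12 : Config (Fin 4) → ℕ := fun _ => 1

/-- `p12` is admissible. -/
lemma p12_isProbVec : IsProbVec p12 := ⟨fun _ => by norm_num [p12], fun _ => by norm_num [p12]⟩

/-- `weight p12 ω = 1/16`. -/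
lemma p12_weight_eq (ω : Config (Fin 4)) : weight p12 ω = (wt12 ω : ℚ) / 16 := by
  unfold weight wt12
  have h : ∀ e : Fin 4, edgeFactor (p12 e) (ω e) = 1 / 2 := fun e => by
    cases ω e <;> norm_num [p12, edgeFactor]
  simp only [h, Finset.prod_const, Finset.card_univ, Fintype.card_fin]
  norm_num

/-- Homogeneous weight `3/4` on five edges. -/
def p34 : Fin 5 → ℚ := fun _ => 3 / 4

/-- Integer weights for `p34`: `3` per open edge, `1` per closed edge (in `4⁻⁵`). -/
def wt34 : Config (Fin 5) → ℕ := fun ω => ∏ e, (if ω e then 3 else 1)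

/-- `p34` is admissible. -/
lemma p34_isProbVec : IsProbVec p34 := ⟨fun _ => by norm_num [p34], fun _ => by norm_num [p34]⟩

/-- `weight p34 ω = wt34 ω / 4⁵`. -/
lemma p34_weight_eq (ω : Config (Fin 5)) : weight p34 ω = (wt34 ω : ℚ) / 4 ^ 5 := by
  unfold weight wt34
  have h : ∀ e : Fin 5, edgeFactor (p34 e) (ω e) = ((if ω e then 3 else 1 : ℕ) : ℚ) / 4 :=
    fun e => by cases ω e <;> norm_num [p34, edgeFactor]
  simp only [h]
  rw [Finset.prod_div_distrib, Nat.cast_prod]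
  simp

end MixedBox

end Summit.Ventures.PercRepro2
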